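/-
Copyright (c) 2026 the pub-hodgecm-mathlib formalisation cell (harness21).  Prover seat hodgecm-mathlib-R90-CS-p03 (g2), R90-TF section S8 «ContSpec-n½» (dealer R90-CS-plan (g3),
S8-R177 «NEXT BY NAME (a-10b) `K2E1ChiArchNonvanishingOfRecordU3`»; file (a-10c) of this seat): ★ (a-10b) `K2E1ChiArchNonvanishingPhaseWeightsU3` RE-KEYED TO THE CURRENCY OF RECORD —
the archimedean weight written with Literature `archUnitaryValue (m_w) 0 (Z_w − 1)` (K2E1-p13's ★ `K2E1ArchSectionLOnBigCellU3` letter, `m_w ∈ ℤ`, `|m_w| ≤ 2`) and with S8-R177's literal phase.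
-/
import Summits.HodgeConjecture.HodgeConjecture.Theorems.K2E1ChiArchNonvanishingPhaseWeightsU3   -- ★ (a-10b): HEAD at `σ = 3∕2` for `ε_w·(ζ_w∕|ζ_w|)^{n_w}`, `n_w : ℕ`, `n_w ≤ 2`
import Literature.NumberTheory.GaloisRepresentations.HeckeCharacterArchType                  -- ★ `archUnitaryValue m t z = (z∕|z|)^m·|z|^{it}`
import HarnessLib

/-!
# K2·E1 ∕ R90·S8 — `K2E1ChiArchNonvanishingOfRecordU3` (file (a-10c)): THE ARCHIMEDEAN HALF OF ★ F5's `hA32` IN THE CURRENCY OF RECORD —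
# `∫_{L_∞}∫_{L⁺_∞} (∏_{w∣∞} ε_w·archUnitaryValue m_w 0 (Z_w − 1))·ARCH₃(Ξ,a)^{−3∕2} dμ_{F,∞} dμ_{E,∞} ≠ 0` for `m : InfinitePlace L → ℤ`, `|m_w| ≤ 2` (`t_w = 0`)

Cell `pub/hodgecm-mathlib`, crux h413 = `stmt-HodgeConjecture-24833`, route of record `HCCMUnconditional`; R90-TF section S8 «ContSpec-n½», road R2-χ₃ ((V)(iii) row `hA32 : A (3∕2) ≠ 0`).
THEOREMS ONLY (no `def`, no `instance`, no notation, no named-fact hypothesis, no `sorry`; default heartbeats); lane `--supports stmt-HodgeConjecture-24833 --as helper` (count-neutral).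

THE `(t_w, m_w)` TABLE OF RECORD (J-S8-∞′ ∕ S8-R157 ∕ S8-R159 ∕ S8-R177; ★ p863753 `K2E1ArchSectionLOnBigCellU3.theta_eq_archUnitaryValue`, ★ p863599 `uPhase_and_dictionary_signOfRecord`): at a complex
place `w` of `L` the archimedean last-row character of the section of record is `Θ_w(λ) = archUnitaryValue (m_w) (−t_w) λ`, `m_w = m₁,w − 2e₂,w ∈ ℤ`, evaluated on the big cell at
`λ_w = ℓ_w = Z_w − 1 = −(1 + ‖X_w‖²∕2) + i·Im Z_w` (Heisenberg relation; ★ `ell_row_two_bigCell`); the block of record has `t_w = 0` (algebraic χ).  In the letters of ★ (a2)₃ ∕ (a-3),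
`Im Z_w = β_w·s_w(a)` with `β_w² = (wδ)²` (the sign is the embedding's), so `Z_w − 1 = ζ_w := ((−(1 + ‖Ξ_w‖²∕2) : ℝ) : ℂ) + ((β_w·s_w a : ℝ) : ℂ)·I` — THIS FILE's HEAD-1 weight is
`∏_w ε_w·archUnitaryValue (m_w) 0 ζ_w` (`0 < ‖ε_w‖ ≤ 1`, `|m_w| ≤ 2`); HEAD-2 is S8-R177's literal phase `ε_w·((A_w − i·(wδ)·s_w)∕|A_w − i·(wδ)·s_w|)^{m_w}` (`= (−1)^{m_w}·archUnitaryValue m_w 0 ζ_w`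
at `β_w = wδ`).  COVERED: `|m_w| ≤ 2` (a negative `m_w` is the conjugate phase: `archUnitaryValue (−n) 0 z = (conj z∕|z|)^n`, and `conj ζ_w(β) = ζ_w(−β)`).  NOT COVERED (HONEST SCOPE,
S8-R177): `|m_w|` odd `≥ 3` (the factor VANISHES at `3∕2` — flag to the dealer: the witness must change `K_∞`-type), `|m_w|` even `≥ 4` (Γ-form file), `t_w ≠ 0`, general real `σ > 1`
(the `m = ±2` core at `σ ≠ 3∕2` needs `∫(A² − B²t²)q^{−σ−1} = (2σ − 2)·B²·∫t²q^{−σ−1}`; on request), and the IDENTIFICATION «`archSectionE` of record on the big cell at `w` `=` this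
weight at `(‖Ξ_w‖, s_w a)`» (K2E1-p13 §2∕§3 ∕ K2E1-p11, against `archSectionE` ONLY, S8-R175).
* §1 `archUnitaryValue` at `t = 0`: `= (z∕|z|)^m` (zpow), `= (z∕|z|)^n` (`m = n`), `= (conj z∕|z|)^n` (`m = −n`), the `if`-normal form in `|m|`; `conj ζ(β) = ζ(−β)`, `|ζ(−β)| = |ζ(β)|`,
  `A − iBs = −ζ(B)`.
* §2 HEAD-1 **`arch_integral_ne_zero_of_record`**, HEAD-2 **`arch_integral_ne_zero_of_record'`** (both at `-(3 / 2 : ℂ)`, ★ (a-3) iterated bytes), over ★ (a-10b).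
HONEST LABEL: HC_CM is proved only modulo the 7 printed citations (2 remaining named inputs: hLiu418 = `stmt-HodgeConjecture-24832`, h413 = `stmt-HodgeConjecture-24833`) until rung 0
closes; REL ≠ ★ ≠ BUILT; this file asserts no named fact and closes no socket ((V)(iii) `hA32` = this × identification × `m_w` table × the finite half); count-neutral.

## References
* [MoeglinWaldspurger1995] C. Mœglin, J.-L. Waldspurger, *Spectral Decomposition and Eisenstein Series* (1995): II.1.7, IV.1.11.
* [Langlands1976] R. P. Langlands, *On the Functional Equations Satisfied by Eisenstein Series*, LNM 544 (1976): Appendix (rank one).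
* [Patrikis2019] S. Patrikis, *Variations on a theorem of Tate*, Mem. AMS 258 (2019): §2.1 (unitary archimedean types).
-/

set_option autoImplicit false
set_option linter.dupNamespace false -- the mandated namespace repeats `HodgeConjecture.HodgeConjecture`

noncomputable section

open MeasureTheory MeasureTheory.Measure NumberField NumberField.InfinitePlace Filter Set
open scoped Topology ComplexConjugate
open Literature.NumberTheory.GaloisRepresentations (archUnitaryValue)
open Summit.HodgeConjecture.HodgeConjecture.Cruxes.H413
open Summit.HodgeConjecture.HodgeConjecture.Cruxes.H413.K2E1ChiArchNonvanishingPhaseWeightsU3 (norm_phaseLetter norm_phaseLetter_pos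
  integral_integral_phaseWeights_mul_arch_cpow_neg_threeHalves_ne_zero)

namespace Summit.HodgeConjecture.HodgeConjecture.Cruxes.H413.K2E1ChiArchNonvanishingOfRecordU3

/-! ## §1 `archUnitaryValue` at `t = 0` and the phase letter -/

/-- **At `t = 0`**: `archUnitaryValue m 0 z = (z∕|z|)^m` (the modulus factor `|z|^{i·0} = 1`). [cite: Patrikis2019, §2.1] -/
theorem archUnitaryValue_zero_right (m : ℤ) (z : ℂ) : archUnitaryValue m 0 z = (z / ((‖z‖ : ℝ) : ℂ)) ^ m := by
  unfold archUnitaryValue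
  rw [Complex.ofReal_zero, zero_mul, Complex.cpow_zero, mul_one]

/-- `archUnitaryValue n 0 z = (z∕|z|)^n` for a natural exponent. [cite: Patrikis2019, §2.1] -/
theorem archUnitaryValue_natCast_zero (n : ℕ) (z : ℂ) : archUnitaryValue (n : ℤ) 0 z = (z / ((‖z‖ : ℝ) : ℂ)) ^ n := by
  rw [archUnitaryValue_zero_right, zpow_natCast]

/-- **A negative exponent is the conjugate phase**: `archUnitaryValue (−n) 0 z = (conj z∕|z|)^n` (`z ≠ 0`; `(z∕|z|)⁻¹ = |z|∕z = conj z∕|z|` as `conj z·z = |z|²`). [cite: Patrikis2019, §2.1] -/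
theorem archUnitaryValue_neg_natCast_zero {z : ℂ} (hz : z ≠ 0) (n : ℕ) : archUnitaryValue (-(n : ℤ)) 0 z = (conj z / ((‖z‖ : ℝ) : ℂ)) ^ n := by
  have hn : ((‖z‖ : ℝ) : ℂ) ≠ 0 := Complex.ofReal_ne_zero.2 (norm_ne_zero_iff.2 hz)
  rw [archUnitaryValue_zero_right, zpow_neg, zpow_natCast, ← inv_pow, inv_div]
  congr 1
  rw [div_eq_div_iff hz hn, ← pow_two, Complex.conj_mul']

/-- **The `|m|`-normal form at `t = 0`**: `archUnitaryValue m 0 z = ((if 0 ≤ m then z else conj z)∕|z|)^{|m|}` (`z ≠ 0`). [cite: Patrikis2019, §2.1] -/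
theorem archUnitaryValue_zero_eq_ite_pow {z : ℂ} (hz : z ≠ 0) (m : ℤ) :
    archUnitaryValue m 0 z = ((if 0 ≤ m then z else conj z) / ((‖z‖ : ℝ) : ℂ)) ^ m.natAbs := by
  obtain ⟨n, rfl | rfl⟩ := Int.eq_nat_or_neg m
  · rw [if_pos (Int.natCast_nonneg n), Int.natAbs_natCast, archUnitaryValue_natCast_zero]
  · rcases Nat.eq_zero_or_pos n with rfl | hn
    · simp [archUnitaryValue_zero_right]
    · rw [if_neg (by omega), Int.natAbs_neg, Int.natAbs_natCast, archUnitaryValue_neg_natCast_zero hz]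

/-- `conj ζ(r, β, s) = ζ(r, −β, s)` for the phase letter `ζ(r, β, s) = −(1 + r²∕2) + i·β·s`. [folklore] -/
theorem conj_phaseLetter (r β s : ℝ) :
    conj ((((-(1 + r ^ 2 / 2)) : ℝ) : ℂ) + ((β * s : ℝ) : ℂ) * Complex.I) = (((-(1 + r ^ 2 / 2)) : ℝ) : ℂ) + (((-β) * s : ℝ) : ℂ) * Complex.I := by
  rw [map_add, map_mul, Complex.conj_ofReal, Complex.conj_ofReal, Complex.conj_I]
  push_cast
  ring

/-- `|ζ(r, −β, s)| = |ζ(r, β, s)|`. [folklore] -/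
theorem norm_phaseLetter_neg (r β s : ℝ) :
    ‖(((-(1 + r ^ 2 / 2)) : ℝ) : ℂ) + (((-β) * s : ℝ) : ℂ) * Complex.I‖ = ‖(((-(1 + r ^ 2 / 2)) : ℝ) : ℂ) + ((β * s : ℝ) : ℂ) * Complex.I‖ := by
  rw [norm_phaseLetter, norm_phaseLetter, neg_sq]

/-- `ζ(r, β, s) ≠ 0`. [folklore] -/
theorem phaseLetter_ne_zero (r β s : ℝ) : (((-(1 + r ^ 2 / 2)) : ℝ) : ℂ) + ((β * s : ℝ) : ℂ) * Complex.I ≠ 0 :=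
  norm_pos_iff.1 (norm_phaseLetter_pos r β s)

/-- **THE BRIDGE AT ONE PLACE**: `archUnitaryValue m 0 ζ(r,β,s) = (ζ(r,β′,s)∕|ζ(r,β′,s)|)^{|m|}` with `β′ = β` if `m ≥ 0` and `β′ = −β` if `m < 0`. [cite: Patrikis2019, §2.1] -/
theorem archUnitaryValue_phaseLetter_eq (m : ℤ) (r β s : ℝ) :
    archUnitaryValue m 0 ((((-(1 + r ^ 2 / 2)) : ℝ) : ℂ) + ((β * s : ℝ) : ℂ) * Complex.I) =
      (((((-(1 + r ^ 2 / 2)) : ℝ) : ℂ) + (((if 0 ≤ m then β else -β) * s : ℝ) : ℂ) * Complex.I) /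
        ((‖(((-(1 + r ^ 2 / 2)) : ℝ) : ℂ) + (((if 0 ≤ m then β else -β) * s : ℝ) : ℂ) * Complex.I‖ : ℝ) : ℂ)) ^ m.natAbs := by
  rw [archUnitaryValue_zero_eq_ite_pow (phaseLetter_ne_zero r β s)]
  split_ifs with h
  · rfl
  · rw [conj_phaseLetter, norm_phaseLetter_neg]

/-- S8-R177's letter: `A − i·B·s = −ζ(r, B, s)` (`A = 1 + r²∕2`). [folklore] -/
theorem sub_mul_I_eq_neg_phaseLetter (r B s : ℝ) :
    (((1 + r ^ 2 / 2 : ℝ)) : ℂ) - ((B * s : ℝ) : ℂ) * Complex.I = -((((-(1 + r ^ 2 / 2)) : ℝ) : ℂ) + ((B * s : ℝ) : ℂ) * Complex.I) := by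
  push_cast
  ring

/-- S8-R177's phase in types: `ε·((A − iBs)∕|A − iBs|)^m = (ε·(−1)^m)·archUnitaryValue m 0 ζ(r, B, s)` (`(−x)^m = (−1)^m x^m` for integer powers in `ℂ`). [cite: Patrikis2019, §2.1] -/
theorem phaseOfRecord_eq (ε : ℂ) (m : ℤ) (r B s : ℝ) :
    ε * (((((1 + r ^ 2 / 2 : ℝ)) : ℂ) - ((B * s : ℝ) : ℂ) * Complex.I) / ((‖(((1 + r ^ 2 / 2 : ℝ)) : ℂ) - ((B * s : ℝ) : ℂ) * Complex.I‖ : ℝ) : ℂ)) ^ m =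
      ε * (-1) ^ m * archUnitaryValue m 0 ((((-(1 + r ^ 2 / 2)) : ℝ) : ℂ) + ((B * s : ℝ) : ℂ) * Complex.I) := by
  rw [sub_mul_I_eq_neg_phaseLetter, norm_neg, archUnitaryValue_zero_right, neg_div, ← neg_one_mul (_ / _), mul_zpow, mul_assoc]

/-! ## §2 HEADS: the archimedean factor at `z = 3∕2` in the currency of record -/

section Head

variable (L : Type) [Field L] [NumberField L] [IsCMField L] {δ : L} (hδ : δ ≠ 0)
  [MeasurableSpace (InfiniteAdeleRing L)] [BorelSpace (InfiniteAdeleRing L)]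
  [MeasurableSpace (InfiniteAdeleRing ↥(maximalRealSubfield L))] [BorelSpace (InfiniteAdeleRing ↥(maximalRealSubfield L))]
  (μE₁ : Measure (InfiniteAdeleRing L)) [μE₁.IsAddHaarMeasure] (μF₁ : Measure (InfiniteAdeleRing ↥(maximalRealSubfield L))) [μF₁.IsAddHaarMeasure]

include hδ in
/-- **HEAD-1 (a-10c).  THE ARCHIMEDEAN FACTOR AT `z = 3∕2` IS NON-ZERO FOR THE WEIGHT OF RECORD `∏_w ε_w·archUnitaryValue (m_w) 0 (Z_w − 1)`**, `Z_w − 1 = ζ_w = −(1 + ‖Ξ_w‖²∕2) + i·β_w·s_w(a)`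
(`β_w² = (wδ)²`, either embedding sign), for all `m : InfinitePlace L → ℤ` with `|m_w| ≤ 2` and all constants `0 < ‖ε_w‖ ≤ 1` — in ★ (a-3)'s iterated bytes at the exponent `−(3∕2 : ℂ)`.
The `(t_w, m_w)` table it serves: `t_w = 0`, `m_w = m₁,w − 2e₂,w` (★ p863753 `theta_eq_archUnitaryValue`), `|m_w| ≤ 2`.  Proof: §1 bridge place by place, then ★ (a-10b) with `n_w = |m_w|` and
`β′_w = ±β_w`. [cite: MoeglinWaldspurger1995, II.1.7, IV.1.11] [cite: Langlands1976, Appendix] [cite: Patrikis2019, §2.1] -/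
theorem arch_integral_ne_zero_of_record (ε : InfinitePlace L → ℂ) (hε1 : ∀ w, ‖ε w‖ ≤ 1) (hε0 : ∀ w, ε w ≠ 0)
    (β : InfinitePlace L → ℝ) (hβ : ∀ w, β w ^ 2 = (w δ) ^ 2) (m : InfinitePlace L → ℤ) (hm : ∀ w, |m w| ≤ 2) :
    (∫ Xi : InfiniteAdeleRing L, ∫ a : InfiniteAdeleRing ↥(maximalRealSubfield L),
      (∏ w : InfinitePlace L, ε w * archUnitaryValue (m w) 0 ((((-(1 + ‖Xi w‖ ^ 2 / 2)) : ℝ) : ℂ) +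
          ((β w * ((InfiniteAdeleRing.ringEquiv_mixedSpace ↥(maximalRealSubfield L)) a).1 ⟨w.comap (algebraMap ↥(maximalRealSubfield L) L), K2E1HeightBigCellLineFormulaU2.isReal_comap_maximalRealSubfield L w⟩ : ℝ) : ℂ) * Complex.I)) *
        ((((∏ w : InfinitePlace L, ((1 + ‖(Xi) w‖ ^ 2 / 2) ^ 2 + (w δ) ^ 2 * (((InfiniteAdeleRing.ringEquiv_mixedSpace ↥(maximalRealSubfield L)) a).1 ⟨w.comap (algebraMap ↥(maximalRealSubfield L) L), K2E1HeightBigCellLineFormulaU2.isReal_comap_maximalRealSubfield L w⟩) ^ 2))) : ℝ) : ℂ) ^ (-(3 / 2 : ℂ)) ∂μF₁ ∂μE₁) ≠ 0 := by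
  have hpt : ∀ (w : InfinitePlace L) (r s : ℝ), archUnitaryValue (m w) 0 ((((-(1 + r ^ 2 / 2)) : ℝ) : ℂ) + ((β w * s : ℝ) : ℂ) * Complex.I) =
      (((((-(1 + r ^ 2 / 2)) : ℝ) : ℂ) + (((if 0 ≤ m w then β w else -β w) * s : ℝ) : ℂ) * Complex.I) /
        ((‖(((-(1 + r ^ 2 / 2)) : ℝ) : ℂ) + (((if 0 ≤ m w then β w else -β w) * s : ℝ) : ℂ) * Complex.I‖ : ℝ) : ℂ)) ^ (m w).natAbs :=
    fun w r s => archUnitaryValue_phaseLetter_eq (m w) r (β w) s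
  simp_rw [hpt]
  refine integral_integral_phaseWeights_mul_arch_cpow_neg_threeHalves_ne_zero L hδ μE₁ μF₁ ε hε1 hε0 (fun w => if 0 ≤ m w then β w else -β w) (fun w => ?_)
    (fun w => (m w).natAbs) fun w => ?_
  · split_ifs
    · exact hβ w
    · rw [neg_sq]; exact hβ w
  · have h := hm w
    rw [Int.abs_eq_natAbs] at h
    exact_mod_cast h

include hδ in
/-- **HEAD-2 (a-10c), S8-R177's literal phase.**  For `m : InfinitePlace L → ℤ` with `|m_w| ≤ 2` and constants `0 < ‖ε_w‖ ≤ 1`, with `A_w = 1 + ‖Ξ_w‖²∕2`, `B_w = wδ`, `s_w = s_w(a)`: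
`∫_{L_∞} ∫_{L⁺_∞} (∏_w ε_w·((A_w − i·B_w·s_w)∕|A_w − i·B_w·s_w|)^{m_w})·ARCH₃(Ξ,a)^{−3∕2} dμ_{F,∞} dμ_{E,∞} ≠ 0` (`(A − iBs)∕|A − iBs| = −ζ(B)∕|ζ(B)|`, so the weight is
`(ε_w(−1)^{m_w})·archUnitaryValue m_w 0 ζ_w(β := wδ)` and HEAD-1 applies). [cite: MoeglinWaldspurger1995, II.1.7, IV.1.11] [cite: Langlands1976, Appendix] -/
theorem arch_integral_ne_zero_of_record' (ε : InfinitePlace L → ℂ) (hε1 : ∀ w, ‖ε w‖ ≤ 1) (hε0 : ∀ w, ε w ≠ 0) (m : InfinitePlace L → ℤ) (hm : ∀ w, |m w| ≤ 2) :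
    (∫ Xi : InfiniteAdeleRing L, ∫ a : InfiniteAdeleRing ↥(maximalRealSubfield L),
      (∏ w : InfinitePlace L, ε w * (((((1 + ‖Xi w‖ ^ 2 / 2 : ℝ)) : ℂ) -
            ((w δ * ((InfiniteAdeleRing.ringEquiv_mixedSpace ↥(maximalRealSubfield L)) a).1 ⟨w.comap (algebraMap ↥(maximalRealSubfield L) L), K2E1HeightBigCellLineFormulaU2.isReal_comap_maximalRealSubfield L w⟩ : ℝ) : ℂ) * Complex.I) /
          ((‖(((1 + ‖Xi w‖ ^ 2 / 2 : ℝ)) : ℂ) -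
            ((w δ * ((InfiniteAdeleRing.ringEquiv_mixedSpace ↥(maximalRealSubfield L)) a).1 ⟨w.comap (algebraMap ↥(maximalRealSubfield L) L), K2E1HeightBigCellLineFormulaU2.isReal_comap_maximalRealSubfield L w⟩ : ℝ) : ℂ) * Complex.I‖ : ℝ) : ℂ)) ^ m w) *
        ((((∏ w : InfinitePlace L, ((1 + ‖(Xi) w‖ ^ 2 / 2) ^ 2 + (w δ) ^ 2 * (((InfiniteAdeleRing.ringEquiv_mixedSpace ↥(maximalRealSubfield L)) a).1 ⟨w.comap (algebraMap ↥(maximalRealSubfield L) L), K2E1HeightBigCellLineFormulaU2.isReal_comap_maximalRealSubfield L w⟩) ^ 2))) : ℝ) : ℂ) ^ (-(3 / 2 : ℂ)) ∂μF₁ ∂μE₁) ≠ 0 := by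
  have hpt : ∀ (w : InfinitePlace L) (r s : ℝ), ε w * (((((1 + r ^ 2 / 2 : ℝ)) : ℂ) - ((w δ * s : ℝ) : ℂ) * Complex.I) / ((‖(((1 + r ^ 2 / 2 : ℝ)) : ℂ) - ((w δ * s : ℝ) : ℂ) * Complex.I‖ : ℝ) : ℂ)) ^ m w =
      ε w * (-1) ^ m w * archUnitaryValue (m w) 0 ((((-(1 + r ^ 2 / 2)) : ℝ) : ℂ) + ((w δ * s : ℝ) : ℂ) * Complex.I) :=
    fun w r s => phaseOfRecord_eq (ε w) (m w) r (w δ) s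
  simp_rw [hpt]
  refine arch_integral_ne_zero_of_record L hδ μE₁ μF₁ (fun w => ε w * (-1) ^ m w) (fun w => ?_) (fun w => ?_) (fun w => w δ) (fun w => rfl) m hm
  · rw [norm_mul, norm_zpow, norm_neg, norm_one, one_zpow, mul_one]
    exact hε1 w
  · exact mul_ne_zero (hε0 w) (zpow_ne_zero _ (neg_ne_zero.2 one_ne_zero))

end Head

end Summit.HodgeConjecture.HodgeConjecture.Cruxes.H413.K2E1ChiArchNonvanishingOfRecordU3

end
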